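import Literature.AlgebraicGeometry.Resolution.StrictTransformIsBlowup
import Literature.AlgebraicGeometry.Limits.IdealSheafExtension
import HarnessLib

/-!
# Separating disjoint opens by an admissible blowing up (Stacks 080P)

Topic: `Literature/AlgebraicGeometry/Resolution`. Stacks, Tag 080P (Divisors, Lemma 31.35.5,
"Separate irreducible components by blowing up"): let `X` be a scheme and `𝓘, 𝓙 ⊆ 𝒪_X` ideal
sheaves of finite type with `𝓘 · 𝓙 = 0` (for `U, V` quasi-compact disjoint opens of a qcqs `X`
one takes finite type ideals with `V(𝓘) = X ∖ U`, `V(𝓙) = X ∖ V` and replaces them by powers,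
`exists_pow_mul_pow_eq_bot`). Let `b : X' → X` be the blowing up in `𝓘 + 𝓙` (a
`U ∪ V`-admissible blowing up). Then `X'` is the disjoint union of the open subschemes
`X'₁ = {𝓙 𝒪_{X'} = 0}` and `X'₂ = {𝓘 𝒪_{X'} = 0}`, with `b⁻¹(U) ⊆ X'₁` and `b⁻¹(V) ⊆ X'₂`.

Proof (a chart-free rendering of the printed one): on an affine open `A = Spec R` of `X'` on
which the exceptional ideal `(𝓘 + 𝓙)𝒪_{X'}` is generated by a non-zero-divisor `t`, we have
`I' + J' = (t)` and `I' J' = 0`; at a prime `𝔭`, `R_𝔭` being local, `I'_𝔭 = (t)` or `J'_𝔭 = (t)`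
(`eq_span_or_eq_span_of_sup_eq_span`), whence `J'_𝔭 = 0` or `I'_𝔭 = 0`, and (finite type) `J'`
or `I'` vanishes on a neighbourhood of `𝔭`; the two loci cannot meet since there `t = 0`.

* `Ideal.eq_span_or_eq_span_of_sup_eq_span`, `Ideal.exists_map_away_eq_bot_of_map_atPrime`;
* `vanishingOpen 𝓚` — the open locus `{𝓚 = 0}` of an ideal sheaf, `ideal_eq_bot_of_le_vanishingOpen`;
* `vanishingOpen_sup_vanishingOpen_eq_top`, `vanishingOpen_inf_vanishingOpen_eq_bot` — **`X'` is
  the disjoint union of `{𝓙𝒪_{X'} = 0}` and `{𝓘𝒪_{X'} = 0}`**;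
* `preimage_centreCompl_le_vanishingOpen` — `b⁻¹(X ∖ V(𝓘)) ⊆ {𝓙𝒪_{X'} = 0}`;
* `exists_pow_mul_pow_eq_bot` — `𝓘ⁿ 𝓙ⁿ = 0` for finite type `𝓘, 𝓙` with `V(𝓘) ∪ V(𝓙) = X`, `X`
  quasi-compact.

## References

* The Stacks Project, Tag 080P (Divisors, Lemma 31.35.5). [StacksProject]
-/

noncomputable section

open CategoryTheory CategoryTheory.Limits AlgebraicGeometry TopologicalSpace

namespace Literature.AlgebraicGeometry.Resolution

universe u

/-! ## Local algebra -/

section Algebra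

variable {R : Type u} [CommRing R]

/-- In a local ring, if `I + J = (t)` with `t` a non-zero-divisor then `I = (t)` or `J = (t)`:
writing `t = at + bt` with `at ∈ I`, `bt ∈ J` gives `a + b = 1`, so `a` or `b` is a unit.
[cite: StacksProject, Tag 080P (proof)] -/
theorem Ideal.eq_span_or_eq_span_of_sup_eq_span [IsLocalRing R] {I J : Ideal R} {t : R}
    (ht : t ∈ nonZeroDivisors R) (h : I ⊔ J = Ideal.span {t}) :
    I = Ideal.span {t} ∨ J = Ideal.span {t} := by
  have htIJ : t ∈ I ⊔ J := h ▸ Ideal.mem_span_singleton_self t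
  obtain ⟨i, hi, j, hj, hij⟩ := Submodule.mem_sup.mp htIJ
  have hiT : i ∈ Ideal.span {t} := h ▸ Ideal.mem_sup_left hi
  have hjT : j ∈ Ideal.span {t} := h ▸ Ideal.mem_sup_right hj
  obtain ⟨a, rfl⟩ := Ideal.mem_span_singleton'.mp hiT
  obtain ⟨b, rfl⟩ := Ideal.mem_span_singleton'.mp hjT
  have hab : a + b = 1 := by
    have h1 : (a + b - 1) * t = 0 := by rw [sub_mul, add_mul, hij, one_mul, sub_self]
    exact sub_eq_zero.mp ((mul_right_mem_nonZeroDivisors_eq_zero_iff ht).mp h1)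
  have hle : ∀ (K : Ideal R), K ≤ I ⊔ J → ∀ (c : R), IsUnit c → c * t ∈ K → K = Ideal.span {t} :=
    fun K hK c hc hcK => le_antisymm (h ▸ hK) ((Ideal.span_singleton_le_iff_mem _).mpr (by
      simpa only [← mul_assoc, IsUnit.val_inv_mul, one_mul] using K.mul_mem_left (↑hc.unit⁻¹ : R) hcK))
  rcases IsLocalRing.isUnit_or_isUnit_of_isUnit_add (hab ▸ isUnit_one) with ha | hb
  · exact Or.inl (hle I le_sup_left a ha hi)
  · exact Or.inr (hle J le_sup_right b hb hj)

/-- If `I J = 0` and `I = (t)` with `t` a non-zero-divisor then `J = 0`. [folklore] -/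
theorem Ideal.eq_bot_of_mul_eq_bot_of_eq_span {I J : Ideal R} {t : R} (ht : t ∈ nonZeroDivisors R)
    (hIJ : I * J = ⊥) (hI : I = Ideal.span {t}) : J = ⊥ := by
  rw [eq_bot_iff]
  intro x hx
  have h : t * x ∈ I * J := Ideal.mul_mem_mul (hI ▸ Ideal.mem_span_singleton_self t) hx
  rw [hIJ, Ideal.mem_bot, mul_comm] at h
  exact (mul_right_mem_nonZeroDivisors_eq_zero_iff ht).mp h

/-- A finitely generated ideal which dies in the localisation at a prime `𝔭` dies in `R[1/g]`
for some `g ∉ 𝔭`. [folklore] -/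
theorem Ideal.exists_map_away_eq_bot_of_map_atPrime {J : Ideal R} (hJ : J.FG) (p : Ideal R)
    [p.IsPrime] (h : J.map (algebraMap R (Localization.AtPrime p)) = ⊥) :
    ∃ g : R, g ∉ p ∧ ∀ (Rg : Type u) [CommRing Rg] [Algebra R Rg] [IsLocalization.Away g Rg],
      J.map (algebraMap R Rg) = ⊥ := by
  classical
  obtain ⟨s, rfl⟩ := hJ
  -- each generator is killed by an element outside `𝔭`
  have hkill : ∀ x ∈ s, ∃ u : R, u ∉ p ∧ u * x = 0 := fun x hx => by
    have hx0 : algebraMap R (Localization.AtPrime p) x = 0 := by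
      rw [← Ideal.mem_bot, ← h]
      exact Ideal.mem_map_of_mem _ (Ideal.subset_span hx)
    obtain ⟨⟨u, hu⟩, hux⟩ := (IsLocalization.map_eq_zero_iff p.primeCompl _ x).mp hx0
    exact ⟨u, hu, hux⟩
  choose! u hu using hkill
  refine ⟨∏ x ∈ s, u x, fun hmem => ?_, fun Rg _ _ _ => ?_⟩
  · obtain ⟨x, hx, hxp⟩ := Ideal.IsPrime.prod_mem_iff.mp hmem
    exact (hu x hx).1 hxp
  · rw [Ideal.map_span, Ideal.span_eq_bot]
    rintro _ ⟨x, hx, rfl⟩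
    rw [IsLocalization.map_eq_zero_iff (Submonoid.powers (∏ x ∈ s, u x))]
    refine ⟨⟨_, Submonoid.mem_powers _⟩, ?_⟩
    show (∏ y ∈ s, u y) * x = 0
    rw [← Finset.mul_prod_erase s u hx, mul_right_comm, (hu x hx).2, zero_mul]

/-- The image of a non-zero-divisor in a localisation is a non-zero-divisor. [folklore] -/
theorem IsLocalization.mem_nonZeroDivisors_algebraMap (M : Submonoid R) (S : Type*) [CommRing S]
    [Algebra R S] [IsLocalization M S] {t : R} (ht : t ∈ nonZeroDivisors R) :
    algebraMap R S t ∈ nonZeroDivisors S :=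
  IsLocalization.nonZeroDivisors_le_comap M S ht

/-- The local dichotomy of Stacks 080P: if `I + J = (t)`, `I J = 0` with `t` a non-zero-divisor
and `I, J` finitely generated, then every prime has a basic open neighbourhood on which `J` or `I`
dies. [cite: StacksProject, Tag 080P (proof)] -/
theorem Ideal.exists_map_away_eq_bot_or {I J : Ideal R} (hIfg : I.FG) (hJfg : J.FG) {t : R}
    (ht : t ∈ nonZeroDivisors R) (hsup : I ⊔ J = Ideal.span {t}) (hmul : I * J = ⊥) (p : Ideal R)
    [p.IsPrime] :
    ∃ g : R, g ∉ p ∧ ∀ (Rg : Type u) [CommRing Rg] [Algebra R Rg] [IsLocalization.Away g Rg],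
      J.map (algebraMap R Rg) = ⊥ ∨ I.map (algebraMap R Rg) = ⊥ := by
  set Rp := Localization.AtPrime p
  have htp : algebraMap R Rp t ∈ nonZeroDivisors Rp :=
    IsLocalization.mem_nonZeroDivisors_algebraMap p.primeCompl Rp ht
  have hsup' : I.map (algebraMap R Rp) ⊔ J.map (algebraMap R Rp) = Ideal.span {algebraMap R Rp t} := by
    rw [← Ideal.map_sup, hsup, Ideal.map_span, Set.image_singleton]
  have hmul' : I.map (algebraMap R Rp) * J.map (algebraMap R Rp) = ⊥ := by
    rw [← Ideal.map_mul, hmul, Ideal.map_bot]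
  rcases Ideal.eq_span_or_eq_span_of_sup_eq_span htp hsup' with hI | hJ
  · obtain ⟨g, hg, h⟩ := Ideal.exists_map_away_eq_bot_of_map_atPrime hJfg p
      (Ideal.eq_bot_of_mul_eq_bot_of_eq_span htp hmul' hI)
    exact ⟨g, hg, fun Rg _ _ _ => Or.inl (h Rg)⟩
  · obtain ⟨g, hg, h⟩ := Ideal.exists_map_away_eq_bot_of_map_atPrime hIfg p
      (Ideal.eq_bot_of_mul_eq_bot_of_eq_span htp ((mul_comm _ _).trans hmul') hJ)
    exact ⟨g, hg, fun Rg _ _ _ => Or.inr (h Rg)⟩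

end Algebra

/-! ## The vanishing locus `{𝓚 = 0}` of an ideal sheaf -/

section Vanishing

variable {X : Scheme.{u}} (K : X.IdealSheafData)

/-- The open locus where the ideal sheaf `𝓚` vanishes: the union of the affine opens `W` with
`𝓚(W) = 0`. [folklore] -/
def vanishingOpen : X.Opens := ⨆ W : {W : X.affineOpens // K.ideal W = ⊥}, (W.1 : X.Opens)

/-- An affine open on which `𝓚` vanishes lies in the vanishing locus. [folklore] -/
theorem le_vanishingOpen {W : X.affineOpens} (hW : K.ideal W = ⊥) : (W : X.Opens) ≤ vanishingOpen K :=
  le_iSup (fun W : {W : X.affineOpens // K.ideal W = ⊥} => (W.1 : X.Opens)) ⟨W, hW⟩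

/-- `𝓚` vanishes on every affine open inside its vanishing locus (vanishing of sections of a
quasi-coherent ideal is local). [folklore] -/
theorem ideal_eq_bot_of_le_vanishingOpen (W : X.affineOpens) (hW : (W : X.Opens) ≤ vanishingOpen K) :
    K.ideal W = ⊥ := by
  rw [eq_bot_iff]
  refine Limits.ideal_le_ideal_of_le_iSup K ⊥ (fun W' : {W : X.affineOpens // K.ideal W = ⊥} =>
    (W'.1 : X.Opens)) (fun W' A hA => ?_) W hW
  rw [← Scheme.IdealSheafData.map_ideal (I := K) (show A ≤ W'.1 from hA), W'.2, Ideal.map_bot]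
  exact bot_le

end Vanishing

/-- On an affine open inside `X ∖ V(𝓘)` the ideal `𝓘` is the unit ideal: the basic opens of
the members of `𝓘(W)` cover `W`. [folklore] -/
theorem ideal_eq_top_of_le_centreCompl {X : Scheme.{u}} (I : X.IdealSheafData) (W : X.affineOpens)
    (hW : (W : X.Opens) ≤ centreCompl I) : I.ideal W = ⊤ := by
  have h := (W.2.iSup_basicOpen_eq_self_iff (s := (I.ideal W : Set Γ(X, W)))).mp
    (le_antisymm (iSup_le fun x => X.basicOpen_le _) fun p hp => by
      have hps : p ∉ I.support := hW hp
      rw [Scheme.IdealSheafData.mem_support_iff_of_mem hp, Scheme.mem_zeroLocus_iff] at hps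
      push Not at hps
      obtain ⟨x, hx, hpx⟩ := hps
      exact Opens.mem_iSup.mpr ⟨⟨x, hx⟩, hpx⟩)
  rwa [Ideal.span_eq] at h

/-! ## The decomposition of the blowing up in `𝓘 + 𝓙` -/

section Decomposition

variable {X X' : Scheme.{u}} (I J : X.IdealSheafData) (b : X' ⟶ X)

/-- **Stacks 080P, the covering**: for finite type ideal sheaves `𝓘, 𝓙` with `𝓘 𝓙 = 0` and
`b : X' → X` with `(𝓘 + 𝓙)𝒪_{X'}` an effective Cartier divisor (e.g. the blowing up in
`𝓘 + 𝓙`), `X'` is covered by the open loci `{𝓙𝒪_{X'} = 0}` and `{𝓘𝒪_{X'} = 0}`.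
[cite: StacksProject, Tag 080P] -/
theorem vanishingOpen_sup_vanishingOpen_eq_top (hI : ∀ W : X.affineOpens, (I.ideal W).FG)
    (hJ : ∀ W : X.affineOpens, (J.ideal W).FG) (hIJ : I * J = ⊥)
    (hE : IsEffectiveCartier ((I ⊔ J).comap b)) :
    vanishingOpen (J.comap b) ⊔ vanishingOpen (I.comap b) = ⊤ := by
  rw [eq_top_iff]
  rintro p -
  obtain ⟨A, hpA, -, t, ht, htA⟩ := hE.exists_chart_le p ⊤ trivial
  rw [Scheme.IdealSheafData.comap_sup, Scheme.IdealSheafData.ideal_sup, Pi.sup_apply] at htA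
  have hmul : (I.comap b).ideal A * (J.comap b).ideal A = ⊥ := by
    rw [← Pi.mul_apply, ← Scheme.IdealSheafData.ideal_mul, ← comap_mul, hIJ,
      Scheme.IdealSheafData.comap_bot, Scheme.IdealSheafData.ideal_bot, Pi.bot_apply]
  obtain ⟨g, hgp, h⟩ := Ideal.exists_map_away_eq_bot_or (fg_ideal_comap b hI A)
    (fg_ideal_comap b hJ A) ht htA hmul (A.2.primeIdealOf ⟨p, hpA⟩).asIdeal
  -- `p ∈ D(g)`
  have hpg : p ∈ X'.basicOpen g := by
    rw [← A.2.fromSpec_image_basicOpen g]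
    exact ⟨A.2.primeIdealOf ⟨p, hpA⟩, hgp, A.2.fromSpec_primeIdealOf ⟨p, hpA⟩⟩
  haveI := A.2.isLocalization_basicOpen g
  have hmapI : ∀ K : X.IdealSheafData,
      ((K.comap b).ideal A).map (algebraMap Γ(X', A) Γ(X', X'.basicOpen g)) = ⊥ →
      (K.comap b).ideal (X'.affineBasicOpen g) = ⊥ := fun K hK => by
    rw [← (K.comap b).map_ideal_basicOpen A g]
    exact hK
  rcases h Γ(X', X'.basicOpen g) with h | h
  · exact Opens.mem_sup.mpr (Or.inl (le_vanishingOpen _ (hmapI J h) hpg))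
  · exact Opens.mem_sup.mpr (Or.inr (le_vanishingOpen _ (hmapI I h) hpg))

/-- **Stacks 080P, the disjointness**: the loci `{𝓙𝒪_{X'} = 0}` and `{𝓘𝒪_{X'} = 0}` are disjoint
when `(𝓘 + 𝓙)𝒪_{X'}` is an effective Cartier divisor (on the intersection its local generator, a
non-zero-divisor, would vanish). [cite: StacksProject, Tag 080P] -/
theorem vanishingOpen_inf_vanishingOpen_eq_bot (hE : IsEffectiveCartier ((I ⊔ J).comap b)) :
    vanishingOpen (J.comap b) ⊓ vanishingOpen (I.comap b) = ⊥ := by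
  rw [eq_bot_iff]
  rintro p ⟨hpJ, hpI⟩
  obtain ⟨A, hpA, hA, t, ht, htA⟩ := hE.exists_chart_le p
    (vanishingOpen (J.comap b) ⊓ vanishingOpen (I.comap b)) ⟨hpJ, hpI⟩
  have hJ0 := ideal_eq_bot_of_le_vanishingOpen (J.comap b) A (hA.trans inf_le_left)
  have hI0 := ideal_eq_bot_of_le_vanishingOpen (I.comap b) A (hA.trans inf_le_right)
  rw [Scheme.IdealSheafData.comap_sup, Scheme.IdealSheafData.ideal_sup, Pi.sup_apply, hI0, hJ0,
    bot_sup_eq, eq_comm, Ideal.span_singleton_eq_bot] at htA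
  -- `t = 0` is a non-zero-divisor: `Γ(X', A) = 0`, so `A = D(1) = D(0) = ∅`
  have h10 : (1 : Γ(X', A)) = 0 := (mul_right_mem_nonZeroDivisors_eq_zero_iff ht).mp (by
    rw [htA, mul_zero])
  have : p ∈ X'.basicOpen (1 : Γ(X', A)) := by
    rw [Scheme.basicOpen_one]
    exact hpA
  rw [h10, Scheme.basicOpen_zero] at this
  exact this

/-- Over `X ∖ V(𝓘)` the ideal `𝓙` vanishes when `𝓘 𝓙 = 0`, hence `𝓙𝒪_{X'}` vanishes over
`b⁻¹(X ∖ V(𝓘))`: **`b⁻¹(U) ⊆ {𝓙𝒪_{X'} = 0}`**. [cite: StacksProject, Tag 080P] -/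
theorem preimage_centreCompl_le_vanishingOpen (hIJ : I * J = ⊥) :
    b ⁻¹ᵁ centreCompl I ≤ vanishingOpen (J.comap b) := by
  intro p hp
  -- an affine neighbourhood `W ⊆ X ∖ V(𝓘)` of `b p` and an affine `A ∋ p` inside `b⁻¹ W`
  obtain ⟨W, hW, hbpW, hWU⟩ := exists_isAffineOpen_mem_and_subset (X := X) (x := b p) (U := centreCompl I) hp
  obtain ⟨A, hA, hpA, hAW⟩ := exists_isAffineOpen_mem_and_subset (X := X') (x := p)
    (U := b ⁻¹ᵁ W) hbpW
  refine le_vanishingOpen (J.comap b) (W := ⟨A, hA⟩) ?_ hpA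
  -- `𝓘(W) = Γ(W)` since `W ⊆ X ∖ V(𝓘)`, so `𝓙(W) = 𝓘(W) 𝓙(W) = 0`
  have hIW : I.ideal ⟨W, hW⟩ = ⊤ := ideal_eq_top_of_le_centreCompl I ⟨W, hW⟩ hWU
  have hJW : J.ideal ⟨W, hW⟩ = ⊥ := by
    rw [← Ideal.top_mul (J.ideal ⟨W, hW⟩)]
    change ⊤ * J.ideal ⟨W, hW⟩ = ⊥
    rw [← hIW, ← Pi.mul_apply, ← Scheme.IdealSheafData.ideal_mul, hIJ,
      Scheme.IdealSheafData.ideal_bot, Pi.bot_apply]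
  rw [ideal_comap_of_le b J ⟨W, hW⟩ ⟨A, hA⟩ hAW, hJW, Ideal.map_bot]

end Decomposition

/-! ## Killing `𝓘 𝓙` by passing to powers -/

section Powers

variable {X : Scheme.{u}}

/-- A finitely generated ideal of sections all of whose members vanish at every point of the
affine open is nilpotent. [folklore] -/
theorem Ideal.exists_pow_eq_bot_of_forall_mem_zeroLocus {R : Type*} [CommRing R] {K : Ideal R}
    (hK : K.FG) (h : K ≤ nilradical R) : ∃ n : ℕ, K ^ n = ⊥ := by
  obtain ⟨n, hn⟩ := Ideal.exists_pow_le_of_le_radical_of_fg (h : K ≤ Ideal.radical ⊥) hK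
  exact ⟨n, le_bot_iff.mp hn⟩

/-- **`𝓘ⁿ 𝓙ⁿ = 0`**: on a quasi-compact scheme, finite type ideal sheaves `𝓘, 𝓙` whose supports
cover `X` (`V(𝓘 𝓙) = X`, i.e. `𝓘 𝓙` is locally nilpotent) satisfy `𝓘ⁿ 𝓙ⁿ = 0` for some `n`.
[cite: StacksProject, Tag 080P (proof)] -/
theorem exists_pow_mul_pow_eq_bot [CompactSpace X] (I J : X.IdealSheafData)
    (hI : ∀ W : X.affineOpens, (I.ideal W).FG) (hJ : ∀ W : X.affineOpens, (J.ideal W).FG)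
    (hsupp : (I * J).support = ⊤) : ∃ n : ℕ, I ^ n * J ^ n = ⊥ := by
  classical
  obtain ⟨s, hs⟩ := Limits.exists_finset_affineOpens_iSup_eq_top X
  -- on each affine open, `(𝓘 𝓙)(W)` is a finitely generated nil ideal
  have hloc : ∀ W : X.affineOpens, ∃ n : ℕ, ((I * J).ideal W) ^ n = ⊥ := fun W => by
    refine Ideal.exists_pow_eq_bot_of_forall_mem_zeroLocus ?_ fun x hx => ?_
    · rw [Scheme.IdealSheafData.ideal_mul, Pi.mul_apply]
      exact (hI W).mul (hJ W)
    -- `x` vanishes at every point of `W`, hence `D(x) = ∅` and `x` is nilpotent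
    have hzero : X.basicOpen x = ⊥ := by
      rw [eq_bot_iff]
      intro p hp
      have hpW : p ∈ (W : X.Opens) := X.basicOpen_le x hp
      have hps : p ∈ (I * J).support := by
        rw [hsupp]
        trivial
      rw [Scheme.IdealSheafData.mem_support_iff_of_mem hpW, Scheme.mem_zeroLocus_iff] at hps
      exact (hps x hx hp).elim
    haveI := W.2.isLocalization_basicOpen x
    have hsub : Subsingleton Γ(X, X.basicOpen x) := by
      rw [hzero]
      exact CommRingCat.subsingleton_of_isTerminal X.sheaf.isTerminalOfEmpty
    obtain ⟨n, hn⟩ := (IsLocalization.subsingleton_iff (M := Submonoid.powers x)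
      (S := Γ(X, X.basicOpen x))).mp hsub
    exact ⟨n, hn⟩
  choose n hn using hloc
  refine ⟨s.sup n, ?_⟩
  -- equality of ideal sheaves is local: check on affine opens inside members of the cover
  apply le_bot_iff.mp
  intro W
  refine Limits.ideal_le_ideal_of_le_iSup (I ^ s.sup n * J ^ s.sup n) ⊥
    (fun V : s => ((V : X.affineOpens) : X.Opens)) (fun V A hA => ?_) W ?_
  · have hle : n (V : X.affineOpens) ≤ s.sup n := Finset.le_sup V.2
    have hV : (I * J).ideal (V : X.affineOpens) ^ s.sup n = ⊥ := by
      rw [← Nat.sub_add_cancel hle, pow_add, hn, Ideal.mul_bot]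
    rw [← mul_pow, Scheme.IdealSheafData.ideal_pow, Pi.pow_apply,
      ← Scheme.IdealSheafData.map_ideal (I := I * J) (show A ≤ (V : X.affineOpens) from hA),
      ← Ideal.map_pow, hV, Ideal.map_bot]
    exact bot_le
  · refine le_top.trans (hs.ge.trans (iSup₂_le fun V hV => ?_))
    exact le_iSup (fun V : s => ((V : X.affineOpens) : X.Opens)) ⟨V, hV⟩

end Powers

/-! ## Stacks 080P as printed -/

section Statement

variable {X : Scheme.{u}}

/-- **Finite type ideal sheaves with prescribed quasi-compact open complement** (Stacks 01PI,
Properties 28.24.1): on a qcqs scheme, for a quasi-compact open `U` there is an ideal sheaf of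
finite type `𝓘` with `V(𝓘) = X ∖ U` — extend the unit ideal sheaf of `U` inside the vanishing
ideal sheaf of `X ∖ U` (Stacks 01PF, `Limits.exists_fg_le_ideal_eq`). [cite: StacksProject, Tag 01PI] -/
theorem exists_fg_support_eq_compl [CompactSpace X] [QuasiSeparatedSpace X] (U : X.Opens)
    (hU : IsCompact (U : Set X)) :
    ∃ I : X.IdealSheafData, (∀ W : X.affineOpens, (I.ideal W).FG) ∧
      (I.support : Set X) = (U : Set X)ᶜ := by
  let Z : Closeds X := ⟨(U : Set X)ᶜ, U.2.isClosed_compl⟩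
  obtain ⟨G, hGfg, hGF, hGU⟩ := Limits.exists_fg_le_ideal_eq U hU
    (Scheme.IdealSheafData.vanishingIdeal Z) ⊤ (fun W _ => ⟨{1}, by simp⟩) fun W hWU => by
    rw [Scheme.IdealSheafData.ideal_top, Pi.top_apply, top_le_iff, eq_top_iff]
    rintro x -
    rw [Scheme.IdealSheafData.vanishingIdeal_ideal, PrimeSpectrum.mem_vanishingIdeal]
    intro q hq
    -- `fromSpec q ∈ W ⊆ U`, not in `Z = X ∖ U`
    have hqW : W.2.fromSpec q ∈ (W : X.Opens) := by
      rw [← SetLike.mem_coe, ← W.2.range_fromSpec]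
      exact Set.mem_range_self _
    exact (hq (hWU hqW)).elim
  refine ⟨G, hGfg, Set.Subset.antisymm (fun p hp hpU => ?_) ?_⟩
  · -- on an affine `W ∋ p` inside `U`, `G(W) = Γ(W)` so `p ∉ V(G)`
    obtain ⟨W, hW, hpW, hWU⟩ := exists_isAffineOpen_mem_and_subset (X := X) (x := p) (U := U) hpU
    have hGW : G.ideal ⟨W, hW⟩ = ⊤ := by
      rw [hGU ⟨W, hW⟩ hWU, Scheme.IdealSheafData.ideal_top, Pi.top_apply]
    rw [SetLike.mem_coe, Scheme.IdealSheafData.mem_support_iff_of_mem (U := ⟨W, hW⟩) hpW,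
      Scheme.mem_zeroLocus_iff] at hp
    exact hp 1 (hGW ▸ Submodule.mem_top) (by rw [Scheme.basicOpen_one]; exact hpW)
  · change (Z : Set X) ⊆ G.support
    exact Scheme.IdealSheafData.le_support_iff_le_vanishingIdeal.mpr hGF

/-- The open complement of the centre of an ideal sheaf with support `X ∖ U` is `U`. [folklore] -/
theorem centreCompl_eq_of_support_eq {I : X.IdealSheafData} {U : X.Opens}
    (h : (I.support : Set X) = (U : Set X)ᶜ) : centreCompl I = U := by
  apply Opens.ext
  change (I.support : Set X)ᶜ = U
  rw [h, compl_compl]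

/-- **Stacks 080P (Divisors, Lemma 31.35.5): separating disjoint quasi-compact opens by an
admissible blowing up.** Let `X` be a quasi-compact and quasi-separated scheme and `U, V ⊆ X`
disjoint quasi-compact opens. Then there is a `U ∪ V`-admissible blowing up `b : X' → X` — the
blowing up in a finite type ideal sheaf `𝓒` with `V(𝓒) ∩ (U ∪ V) = ∅` — such that `X'` is the
disjoint union of two open subschemes `X'₁ ⊔ X'₂ = X'`, `X'₁ ∩ X'₂ = ∅`, with `b⁻¹(U) ⊆ X'₁` and
`b⁻¹(V) ⊆ X'₂`. [cite: StacksProject, Tag 080P] -/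
theorem exists_isBlowup_separating [CompactSpace X] [QuasiSeparatedSpace X] (U V : X.Opens)
    (hU : IsCompact (U : Set X)) (hV : IsCompact (V : Set X)) (hUV : Disjoint U V) :
    ∃ (C : X.IdealSheafData) (X' : Scheme.{u}) (b : X' ⟶ X) (X₁ X₂ : X'.Opens),
      (∀ W : X.affineOpens, (C.ideal W).FG) ∧
      Disjoint ((U ⊔ V : X.Opens) : Set X) (C.support : Set X) ∧ IsBlowup b C ∧
      X₁ ⊔ X₂ = ⊤ ∧ X₁ ⊓ X₂ = ⊥ ∧ b ⁻¹ᵁ U ≤ X₁ ∧ b ⁻¹ᵁ V ≤ X₂ := by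
  obtain ⟨I, hIfg, hIsupp⟩ := exists_fg_support_eq_compl U hU
  obtain ⟨J, hJfg, hJsupp⟩ := exists_fg_support_eq_compl V hV
  -- `V(𝓘 𝓙) = X`, so `𝓘ⁿ 𝓙ⁿ = 0`; replace `𝓘, 𝓙` by `𝓘ⁿ⁺¹, 𝓙ⁿ⁺¹`
  have hsupp : (I * J).support = ⊤ := by
    apply SetLike.coe_injective
    rw [Scheme.IdealSheafData.support_mul, Closeds.coe_sup, hIsupp, hJsupp, Closeds.coe_top,
      ← Set.compl_inter, Set.compl_univ_iff]
    rw [← Opens.coe_inf, ← Opens.coe_bot]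
    exact congrArg SetLike.coe (disjoint_iff.mp hUV)
  obtain ⟨n, hn⟩ := exists_pow_mul_pow_eq_bot I J hIfg hJfg hsupp
  have hIJ : I ^ (n + 1) * J ^ (n + 1) = ⊥ := by
    rw [pow_succ, pow_succ, mul_mul_mul_comm, hn, Scheme.IdealSheafData.bot_mul]
  set I' := I ^ (n + 1) with hI'
  set J' := J ^ (n + 1) with hJ'
  have hI'fg : ∀ W : X.affineOpens, (I'.ideal W).FG := fun W => by
    rw [hI', Scheme.IdealSheafData.ideal_pow, Pi.pow_apply]
    exact (hIfg W).pow
  have hJ'fg : ∀ W : X.affineOpens, (J'.ideal W).FG := fun W => by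
    rw [hJ', Scheme.IdealSheafData.ideal_pow, Pi.pow_apply]
    exact (hJfg W).pow
  have hI'supp : (I'.support : Set X) = (U : Set X)ᶜ := by
    rw [hI', Scheme.IdealSheafData.support_pow_succ, hIsupp]
  have hJ'supp : (J'.support : Set X) = (V : Set X)ᶜ := by
    rw [hJ', Scheme.IdealSheafData.support_pow_succ, hJsupp]
  -- blow up `𝓘' + 𝓙'`
  obtain ⟨X', b, hb⟩ := Stacks01OG_holds X (I' ⊔ J')
  refine ⟨I' ⊔ J', X', b, vanishingOpen (J'.comap b), vanishingOpen (I'.comap b), fun W => ?_, ?_,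
    hb, vanishingOpen_sup_vanishingOpen_eq_top I' J' b hI'fg hJ'fg hIJ hb.isEffectiveCartier,
    vanishingOpen_inf_vanishingOpen_eq_bot I' J' b hb.isEffectiveCartier, ?_, ?_⟩
  · rw [Scheme.IdealSheafData.ideal_sup, Pi.sup_apply]
    exact Submodule.FG.sup (hI'fg W) (hJ'fg W)
  · rw [Scheme.IdealSheafData.support_sup, Closeds.coe_inf, hI'supp, hJ'supp, Opens.coe_sup,
      ← Set.compl_union]
    exact disjoint_compl_right
  · rw [← centreCompl_eq_of_support_eq hI'supp]
    exact preimage_centreCompl_le_vanishingOpen I' J' b hIJ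
  · rw [← centreCompl_eq_of_support_eq hJ'supp]
    exact preimage_centreCompl_le_vanishingOpen J' I' b ((mul_comm _ _).trans hIJ)

end Statement

end Literature.AlgebraicGeometry.Resolution

end
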